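import Summits.QuantumFields.BalabanUV.T4Continuum.Support.OutputRateOpGaussian

/-!
# OutputRateOpGaussianMargin — the POSITIVITY MARGIN of the (2.14)-SHAPED Gaussian exponent AT REAL DATA is a THEOREM of the shape, with
# an explicit constant in three operator-norm letters; on the complex operator ball it persists under an ARITHMETIC smallness of the
# operator margin (cell `pub-balaban`, T⁴ fan-out, `HOME/BINDER-OWNERS.md` row NE5, owner lineage t4-ne5-p1, gen 28, route P1)

HONEST FRAMING (T4-DAG PAGE 1).  Rung (B)+1 on ONE finite four-torus — NOT infinite volume, NOT a mass gap, NOT the Clay problem;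
`FlowStep.BetaPertH`, (B), (B^μ) do not occur here.  NE5 is NOT PRINTED and NOT PROVED (spine 0/9).  Nothing of Bałaban's series is asserted;
0 cite tags.  The located print (quoted in the lineage's loci sheet `b13-loci.md` and the leaf `T4InputCauchyRateData` §11): [II] =
[Balaban1988RG2Cluster] p. 15 (2.14) — the resummed term's Gaussian skeleton `∫dμ₀(X) exp(−½⟨Γ_kX, C^{(k)}Γ_kX⟩) ∫dμ_{C^{(k)}}(B)
exp(−⟨B, Γ_kX⟩) …`, all operators at `(Z₀, σ(Z))`; p. 16 (2.16)/(2.21) — kernel bounds of the operator replacements `R₁`, `R₂`.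
HONEST DEPENDENCY (cell, verbatim): continuum YM on T⁴ ⇐ BetaPertH ∧ nine spine estimates (0/9 proved); BetaPertH ⇐ (D1) ∧ (D4) ∧
CAP+tail; G-an2-4 gates asym, D1 and NE2/3/4.

WHAT THIS MODULE IS.  `OutputRateOpGaussian` (p213354) reduced the operator half of W2, for complex Gaussian terms, to ONE input: a margin
`Re q(o, v) ≥ m‖v‖²` uniform on the operator ball.  Written with the Gaussian `dμ_{C}(B)` as a density (`K = C⁻¹`) and the outer measure
`dμ₀(X)` contributing `½⟨X, A₀X⟩`, the (2.14) exponent at REAL data is the BLOCK FORM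
  `Q₀(X, B) = ½⟨X, A₀X⟩ + ½⟨ΓX, CΓX⟩ + ½⟨B, KB⟩ + ⟨B, ΓX⟩ = ½⟨X, A₀X⟩ + ½⟨B + CΓX, K(B + CΓX)⟩`
(the completed square, §3 — this is WHY the bare `(ΓX, B)`-form is only semidefinite: without `dμ₀` the `B`-integral cancels the prefactor
exactly).  §1–§2 prove the MARGIN of such block forms with the explicit constant `m₀ = a₀c₁/(2(a₀ + c₁ + c₁s²))` in the three letters
`a₀` (lower bound of `A₀`), `c₁` (lower bound of `K = C⁻¹`, i.e. `‖C‖⁻¹`), `s` (`‖CΓ‖`) — one polynomial identity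
`(a₀x − c₁sw)² + c₁²w² ≥ 0`, no case split, no spectral theory; §4 transports a base margin to the complex operator ball under a Lipschitz
displacement of the exponent (`re_ge_of_baseMargin_lipschitz`: margin `m₀ − m₁R′`, the general form of `re_affineExponent_ge`); §5 (v1.1,
APPEND-ONLY) glue: `re_add_ge_of_margin_of_small` (a part bounded by `ε·N` keeps the margin `m₀ − ε` — the `τ(Y)𝐕_k` factor) and
`written_exponent_margin_L2` (the margin on `WithLp 2 (VX × VB)`, `‖v‖² = ‖X‖² + ‖B‖²`, in the form `TermOpGaussian`'s margin clause reads).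
CENSUS CONSEQUENCE (the re-typed wall, Edison rule).  For the Gaussian skeleton of (2.14), W2-op's MARGIN is now: (i) at real data a
THEOREM of the SHAPE given the three letters (printed KIND: the operator bounds behind (2.16)/(2.21) and (1.5)/(1.7)); (ii) on the complex
operator ball of radius `rOp` an ARITHMETIC side condition `m₁·rOp < m₀` on the operator margin (like leaves L10/L11 of `SKELETON-NE5-P1`),
`m₁` = the Lipschitz modulus of the exponent in the operator datum; what is NOT covered: the dictionary (H-rep) itself, the `τ(Y)𝐕_k(Y,B)`
quadratic part `½⟨Q(Y)B, B⟩` ((1.43): absorbed when `Σ|τ(Y)|‖Q(Y)‖ ≤ m₀` — a further arithmetic smallness in printed letters) and the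
non-Gaussian remainder `V″` inside the insertion.  No wall is discharged from print; W2-op CONSTANT-only; NE5 NOT PROVED; spine 0/9; rung (B)+1
finite T⁴; NOT infinite volume / mass gap / Clay.  0 sorry; axioms ⊆ {propext, Classical.choice, Quot.sound}.
-/

noncomputable section

open Set Metric
open scoped RealInnerProductSpace

namespace Summit.QuantumFields.BalabanUV.T4Continuum.OutputRateOpGaussianMargin

/-! ## §1 The scalar inequality behind the block margin -/

/-- **THE POLYNOMIAL INEQUALITY**: for `a₀, c₁ > 0` and reals `s, x, w`, `0 ≤ b ≤ w + s·x`: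
`a₀c₁·(x² + b²) ≤ (a₀ + c₁ + c₁s²)·(a₀x² + c₁w²)` — from `(a₀x − c₁sw)² + c₁²w² ≥ 0` and the monotonicity of `b ↦ b²`. [folklore] -/
theorem block_margin_scalar {a₀ c₁ s x w b : ℝ} (ha₀ : 0 < a₀) (hc₁ : 0 < c₁) (hb : 0 ≤ b) (hbw : b ≤ w + s * x) : a₀ * c₁ * (x ^ 2 + b ^ 2) ≤ (a₀ + c₁ + c₁ * s ^ 2) * (a₀ * x ^ 2 + c₁ * w ^ 2) := by
  have hb2 : b ^ 2 ≤ (w + s * x) ^ 2 := pow_le_pow_left₀ hb hbw 2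
  have hkey : a₀ * c₁ * (x ^ 2 + (w + s * x) ^ 2) ≤ (a₀ + c₁ + c₁ * s ^ 2) * (a₀ * x ^ 2 + c₁ * w ^ 2) := by
    nlinarith [sq_nonneg (a₀ * x - c₁ * s * w), sq_nonneg (c₁ * w), mul_pos ha₀ hc₁]
  have hmono : a₀ * c₁ * (x ^ 2 + b ^ 2) ≤ a₀ * c₁ * (x ^ 2 + (w + s * x) ^ 2) :=
    mul_le_mul_of_nonneg_left (by linarith) (mul_pos ha₀ hc₁).le
  exact hmono.trans hkey

/-- the block margin constant `m₀ = a₀c₁/(2(a₀ + c₁ + c₁s²))`. [folklore] -/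
def blockMargin (a₀ c₁ s : ℝ) : ℝ := a₀ * c₁ / (2 * (a₀ + c₁ + c₁ * s ^ 2))

/-- `m₀ > 0`. [folklore] -/
theorem blockMargin_pos {a₀ c₁ s : ℝ} (ha₀ : 0 < a₀) (hc₁ : 0 < c₁) : 0 < blockMargin a₀ c₁ s := by
  unfold blockMargin; positivity

/-! ## §2 The margin of a completed-square block form on a pair of real normed spaces -/

section Block

variable {VX VB : Type*} [NormedAddCommGroup VX] [NormedAddCommGroup VB]

/-- **BLOCK MARGIN (norm form)**: if `‖T X‖ ≤ s‖X‖` then `½a₀‖X‖² + ½c₁‖B + T X‖² ≥ m₀·(‖X‖² + ‖B‖²)` with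
`m₀ = a₀c₁/(2(a₀ + c₁ + c₁s²))` (`a₀, c₁ > 0`). [folklore] -/
theorem block_margin_norm {a₀ c₁ s : ℝ} (ha₀ : 0 < a₀) (hc₁ : 0 < c₁) {T : VX → VB} (hT : ∀ X, ‖T X‖ ≤ s * ‖X‖)
    (X : VX) (B : VB) :
    blockMargin a₀ c₁ s * (‖X‖ ^ 2 + ‖B‖ ^ 2) ≤ 1 / 2 * a₀ * ‖X‖ ^ 2 + 1 / 2 * c₁ * ‖B + T X‖ ^ 2 := by
  have hbw : ‖B‖ ≤ ‖B + T X‖ + s * ‖X‖ :=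
    calc ‖B‖ = ‖(B + T X) - T X‖ := by rw [add_sub_cancel_right]
      _ ≤ ‖B + T X‖ + ‖T X‖ := norm_sub_le _ _
      _ ≤ ‖B + T X‖ + s * ‖X‖ := by gcongr; exact hT X
  have h := block_margin_scalar ha₀ hc₁ (norm_nonneg B) hbw
  have hden : 0 < 2 * (a₀ + c₁ + c₁ * s ^ 2) := by positivity
  rw [blockMargin, div_mul_eq_mul_div, div_le_iff₀ hden]
  nlinarith [h]

variable [InnerProductSpace ℝ VX] [InnerProductSpace ℝ VB]

/-- **BLOCK MARGIN (form form)**: with a coercive outer form `⟨X, A₀X⟩ ≥ a₀‖X‖²` (the covariance of `dμ₀`) and a coercive inner form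
`⟨w, Kw⟩ ≥ c₁‖w‖²` (`K = C⁻¹`, `c₁ = ‖C‖⁻¹`), `½⟨X, A₀X⟩ + ½⟨B + TX, K(B + TX)⟩ ≥ m₀·(‖X‖² + ‖B‖²)`. [folklore] -/
theorem block_margin_form {a₀ c₁ s : ℝ} (ha₀ : 0 < a₀) (hc₁ : 0 < c₁) {A₀ : VX → VX} {K : VB → VB} {T : VX → VB}
    (hA₀ : ∀ X, a₀ * ‖X‖ ^ 2 ≤ ⟪X, A₀ X⟫) (hK : ∀ w, c₁ * ‖w‖ ^ 2 ≤ ⟪w, K w⟫) (hT : ∀ X, ‖T X‖ ≤ s * ‖X‖) (X : VX) (B : VB) :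
    blockMargin a₀ c₁ s * (‖X‖ ^ 2 + ‖B‖ ^ 2) ≤ 1 / 2 * ⟪X, A₀ X⟫ + 1 / 2 * ⟪B + T X, K (B + T X)⟫ := by
  have h := block_margin_norm ha₀ hc₁ hT X B
  have h1 := hA₀ X
  have h2 := hK (B + T X)
  linarith

/-! ## §3 The completed square: the (2.14)-written exponent IS the block form -/

/-- **COMPLETING THE SQUARE**: for `K ∘ C = id` and `K` symmetric, `½⟨B + C(ΓX), K(B + C(ΓX))⟩ = ½⟨ΓX, C(ΓX)⟩ + ½⟨B, KB⟩ + ⟨B, ΓX⟩` — the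
Gaussian part of the (2.14) exponent as written (prefactor `½⟨ΓX, CΓX⟩`, density `½⟨B, C⁻¹B⟩` of `dμ_C`, coupling `⟨B, ΓX⟩`) equals the
completed square. [folklore] -/
theorem completed_square {C K : VB → VB} (hK : ∀ u v : VB, ⟪K u, v⟫ = ⟪u, K v⟫) (hKC : ∀ v, K (C v) = v)
    (hadd : ∀ u v, K (u + v) = K u + K v) (gX B : VB) :
    1 / 2 * ⟪B + C gX, K (B + C gX)⟫ = 1 / 2 * ⟪gX, C gX⟫ + 1 / 2 * ⟪B, K B⟫ + ⟪B, gX⟫ := by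
  rw [hadd, hKC, inner_add_left, inner_add_right, inner_add_right]
  have h1 : ⟪C gX, K B⟫ = ⟪B, gX⟫ := by rw [← hK, hKC, real_inner_comm]
  have h2 : ⟪C gX, gX⟫ = ⟪gX, C gX⟫ := real_inner_comm _ _
  rw [h1, h2]
  ring

/-- **THE MARGIN OF THE (2.14)-WRITTEN EXPONENT AT REAL DATA**: with `dμ₀`'s form `⟨X, A₀X⟩ ≥ a₀‖X‖²`, `K = C⁻¹` symmetric additive with
`⟨w, Kw⟩ ≥ c₁‖w‖²`, and `‖C(ΓX)‖ ≤ s‖X‖`: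
`½⟨X, A₀X⟩ + ½⟨ΓX, C(ΓX)⟩ + ½⟨B, KB⟩ + ⟨B, ΓX⟩ ≥ m₀·(‖X‖² + ‖B‖²)`, `m₀ = a₀c₁/(2(a₀ + c₁ + c₁s²)) > 0`. [folklore] -/
theorem written_exponent_margin {a₀ c₁ s : ℝ} (ha₀ : 0 < a₀) (hc₁ : 0 < c₁) {A₀ : VX → VX} {C K : VB → VB}
    {Γ : VX → VB} (hA₀ : ∀ X, a₀ * ‖X‖ ^ 2 ≤ ⟪X, A₀ X⟫) (hK : ∀ w, c₁ * ‖w‖ ^ 2 ≤ ⟪w, K w⟫)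
    (hKsymm : ∀ u v : VB, ⟪K u, v⟫ = ⟪u, K v⟫) (hKC : ∀ v, K (C v) = v) (hadd : ∀ u v, K (u + v) = K u + K v)
    (hCΓ : ∀ X, ‖C (Γ X)‖ ≤ s * ‖X‖) (X : VX) (B : VB) :
    blockMargin a₀ c₁ s * (‖X‖ ^ 2 + ‖B‖ ^ 2) ≤
      1 / 2 * ⟪X, A₀ X⟫ + 1 / 2 * ⟪Γ X, C (Γ X)⟫ + 1 / 2 * ⟪B, K B⟫ + ⟪B, Γ X⟫ := by
  have h := block_margin_form ha₀ hc₁ (T := fun X => C (Γ X)) hA₀ hK hCΓ X B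
  have hsq := completed_square hKsymm hKC hadd (Γ X) B
  linarith

end Block

/-! ## §4 From the base margin to the complex operator ball: Lipschitz displacement of the exponent -/

section Displacement

variable {V : Type*} {Op : Type*} [NormedAddCommGroup Op]

/-- **BASE MARGIN + LIPSCHITZ DISPLACEMENT ⟹ MARGIN ON THE BALL** (the general form of `OutputRateOpGaussian.re_affineExponent_ge`): if
`Re q(c, v) ≥ m₀·N(v)` at the base operator datum and the exponent moves by at most `m₁‖o − c‖·N(v)`, then on `ball c R′`
`Re q(o, v) ≥ (m₀ − m₁R′)·N(v)` (`N ≥ 0` any weight, e.g. `‖X‖² + ‖B‖²`).  The margin survives iff `m₁R′ < m₀` — an ARITHMETIC side condition on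
the operator margin. [folklore] -/
theorem re_ge_of_baseMargin_lipschitz {q : Op → V → ℂ} {c : Op} {m₀ m₁ R' : ℝ} {N : V → ℝ} (hN : ∀ v, 0 ≤ N v) (hm₁ : 0 ≤ m₁)
    (hbase : ∀ v, m₀ * N v ≤ (q c v).re) (hlip : ∀ o v, ‖q o v - q c v‖ ≤ m₁ * ‖o - c‖ * N v) {o : Op} (ho : o ∈ ball c R')
    (v : V) : (m₀ - m₁ * R') * N v ≤ (q o v).re := by
  rw [mem_ball, dist_eq_norm] at ho
  have h1 : ‖q o v - q c v‖ ≤ m₁ * R' * N v :=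
    (hlip o v).trans (mul_le_mul_of_nonneg_right (mul_le_mul_of_nonneg_left ho.le hm₁) (hN v))
  have h2 : -(m₁ * R' * N v) ≤ (q o v - q c v).re := (neg_le_neg h1).trans (abs_le.1 (Complex.abs_re_le_norm _)).1
  rw [Complex.sub_re] at h2
  nlinarith [hbase v]

end Displacement

/-! ## §5 (v1.1) Glue: a small quadratic part keeps the margin; the L²-product form feeding `TermOpGaussian` -/

section Glue

variable {V : Type*}

/-- **A SMALL EXTRA PART KEEPS THE MARGIN** (the `τ(Y)·𝐕_k(Y, B)` factor of (2.14): by (1.42)–(1.43) its quadratic part `½⟨Q(Y)B, B⟩` has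
tiny matrix elements, printed KIND): if `Re q(v) ≥ m₀·N(v)` and the extra exponent is bounded by `ε·N(v)`, then `Re (q(v) + p(v)) ≥ (m₀ − ε)·N(v)`
— the margin survives iff `ε < m₀`, an ARITHMETIC smallness in printed letters. [folklore] -/
theorem re_add_ge_of_margin_of_small {q p : V → ℂ} {m₀ ε : ℝ} {N : V → ℝ} (hbase : ∀ v, m₀ * N v ≤ (q v).re)
    (hp : ∀ v, ‖p v‖ ≤ ε * N v) (v : V) : (m₀ - ε) * N v ≤ (q v + p v).re := by
  have h2 : -(ε * N v) ≤ (p v).re := (neg_le_neg (hp v)).trans (abs_le.1 (Complex.abs_re_le_norm _)).1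
  rw [Complex.add_re]
  nlinarith [hbase v]

variable {VX VB : Type*} [NormedAddCommGroup VX] [NormedAddCommGroup VB] [InnerProductSpace ℝ VX] [InnerProductSpace ℝ VB]

/-- **THE L²-PRODUCT FORM** (glue to `OutputRateOpGaussian.TermOpGaussian`, whose margin clause reads `m·‖v‖² ≤ Re q(o, v)` on ONE inner
product space): on `V = WithLp 2 (VX × VB)` (so `‖v‖² = ‖X‖² + ‖B‖²`), a complex exponent whose real part at the base operator datum IS the
(2.14)-written form has the margin `blockMargin a₀ c₁ s·‖v‖² ≤ Re q₀(v)`. [folklore] -/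
theorem written_exponent_margin_L2 {a₀ c₁ s : ℝ} (ha₀ : 0 < a₀) (hc₁ : 0 < c₁) {A₀ : VX → VX} {C K : VB → VB} {Γ : VX → VB}
    (hA₀ : ∀ X, a₀ * ‖X‖ ^ 2 ≤ ⟪X, A₀ X⟫) (hK : ∀ w, c₁ * ‖w‖ ^ 2 ≤ ⟪w, K w⟫) (hKsymm : ∀ u v : VB, ⟪K u, v⟫ = ⟪u, K v⟫)
    (hKC : ∀ v, K (C v) = v) (hadd : ∀ u v, K (u + v) = K u + K v) (hCΓ : ∀ X, ‖C (Γ X)‖ ≤ s * ‖X‖)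
    {q₀ : WithLp 2 (VX × VB) → ℂ}
    (hq₀ : ∀ v : WithLp 2 (VX × VB), (q₀ v).re =
      1 / 2 * ⟪v.fst, A₀ v.fst⟫ + 1 / 2 * ⟪Γ v.fst, C (Γ v.fst)⟫ + 1 / 2 * ⟪v.snd, K v.snd⟫ + ⟪v.snd, Γ v.fst⟫)
    (v : WithLp 2 (VX × VB)) : blockMargin a₀ c₁ s * ‖v‖ ^ 2 ≤ (q₀ v).re := by
  rw [WithLp.prod_norm_sq_eq_of_L2, hq₀]
  exact written_exponent_margin ha₀ hc₁ hA₀ hK hKsymm hKC hadd hCΓ v.fst v.snd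

end Glue

end Summit.QuantumFields.BalabanUV.T4Continuum.OutputRateOpGaussianMargin

end
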